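import Mathlib
import Summits.Ventures.PercRepro.PuncturedLYMUnif46Table

/-!
# PercRepro — (SP) FOR ANY NUMBER OF PAIRWISE DISJOINT `4`-SETS AT LEVEL `6`: THE COLUMN IDENTITIES (4)
(p10, gen 40)

For each free column class `(d1, …, d3)` (`Σ v d_v ≤ 7`): the `v d_v` rows obtained by removing a point of a member met in `v`
points (class `d − e_v + e_{v−1}`, direction `v − 1`) and the `7 − Σ v d_v` rows obtained by removing a free point (class `d`,
direction `4`) carry total weight `1`.  The member columns carry `4 · (1/4) = 1`.  Nothing here asserts (SP).
-/

namespace PercRepro.PuncturedLYM.Split.TypeLift.Unif46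

set_option maxHeartbeats 4000000 in
set_option maxRecDepth 20000 in
/-- The column identity of the free column class `(3, 2, 0)`. -/
theorem col_320 (n k : ℚ) (hQ : Qp n k ≠ 0) (hP : Pp n k ≠ 0) :
    1 * 3 * raw n k 2 2 0 0 + 2 * 2 * raw n k 4 1 0 1 = 1 := by
  simp (config := {decide := true}) only [raw, sel, sel_220, sel_410, if_true, if_false]
  field_simp
  unfold Qp Pp N_220_D0 N_410_D1
  ring

set_option maxHeartbeats 4000000 in
set_option maxRecDepth 20000 in
/-- The column identity of the free column class `(4, 0, 1)`. -/
theorem col_401 (n k : ℚ) (hQ : Qp n k ≠ 0) (hP : Pp n k ≠ 0) :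
    1 * 4 * raw n k 3 0 1 0 + 3 * 1 * raw n k 4 1 0 2 = 1 := by
  simp (config := {decide := true}) only [raw, sel, sel_301, sel_410, if_true, if_false]
  field_simp
  unfold Qp Pp N_301_D0 N_410_D2
  ring

set_option maxHeartbeats 4000000 in
set_option maxRecDepth 20000 in
/-- The column identity of the free column class `(5, 1, 0)`. -/
theorem col_510 (n k : ℚ) (hQ : Qp n k ≠ 0) (hP : Pp n k ≠ 0) :
    1 * 5 * raw n k 4 1 0 0 + 2 * 1 * raw n k 6 0 0 1 = 1 := by
  simp (config := {decide := true}) only [raw, sel, sel_410, sel_600, if_true, if_false]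
  field_simp
  unfold Qp Pp N_410_D0 N_600_D1
  ring

set_option maxHeartbeats 4000000 in
set_option maxRecDepth 20000 in
/-- The column identity of the free column class `(7, 0, 0)`. -/
theorem col_700 (n k : ℚ) (hQ : Qp n k ≠ 0) (hP : Pp n k ≠ 0) :
    1 * 7 * raw n k 6 0 0 0 = 1 := by
  simp (config := {decide := true}) only [raw, sel, sel_600, if_true, if_false]
  field_simp
  unfold Qp Pp N_600_D0
  ring

end PercRepro.PuncturedLYM.Split.TypeLift.Unif46
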